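import Literature.Probability.Percolation.MarkedLoopHolomorphicDefect
import Literature.Probability.Percolation.MarkedLoopRotation
import Literature.Probability.Percolation.TriHexBallDomain
import HarnessLib

/-!
# Five disorders: the tripod law is NECESSARY for discrete holomorphicity («TRIPOD-NECESSITY-FIVE»)

Topic `Literature/Probability/Percolation`; generic-`k` layer of the three-disorder lineage (Khristoforov–Smirnov 2021) at `k = 5`, a sequel
of `MarkedLoopHolomorphicDefect.lean` (TRIPOD-DEFECT: for EVERY class weight `wt`, at every face `v` with three `H_G`-sides,
`Σ_i τ^i ObsW D wt v i = Σ_P c_P(v) · tripodDefect wt P`, `c_P(v) ∈ ℕ` the number of re-linking cores at `v` with picture `P`) and of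
`MarkedLoopRotation.lean` (ROT: rotating the marks of the DOMAIN is rotating the WEIGHT, `holomorphicW_rotate_iff`). HOLO-K
(`MarkedLoopHolomorphy.lean`) proves «tripod law ⇒ discretely holomorphic on every `k`-marked domain»; `MarkedLoopRelinkIndex.lean` proves
the converse at `k = 3`. This file proves THE CONVERSE AT `k = 5`:

* `§ Five` — ★ `tripodPicture_five`: a tripod picture on five corners is one of the three anticlockwise readings of a CONSECUTIVE triple
  `(c+2, c+3, c+4)` with relation the single pair `{c, c+1}` (planarity excludes the triples `{c, c+1, c+3}`); `tripodPicture_classRep`;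
  the CLASS DEFECTS `classDefect wt c` (`c : Fin 5`) and ★ `tripodLaw_five_iff` — at five marks the tripod law is FIVE relations
  `δ_c(wt) = 0`; `classDefect_rotW_symm` / `classDefect_iterate` — back-rotating the marks shifts the class index; `forall_holomorphicW_iterate`
  — «holomorphic on every five-marked domain» is stable under the rotations (apply the hypothesis to the rotated domain).
* `§ CornerSide` (every `k`) — `hasPicture_corner_side` / `picFst_eq_of_corner_side` …: if the neighbour of `v` across side `i` IS the
  corner face `y_a`, every picture counted at `v` reads `a` at position `i` (a corner neighbour is its own partner).
* `§ Witness` — the five-marked hexagon of radius 2 with NEARBY marks `hexBall2Near` (sites `triBall 2`, marks at the consecutive markable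
  boundary sites `(2,-1), (2,0), (1,1), (0,2), (-1,2)`; disc fields from the tree's `hexBall2Five`, mark fields and corner faces `cornerN` by
  `decide`); the DOWN face `vN = ((0,1),1)`, whose sides `0` and `2` are shared with the corner faces `y_3` and `y_2` (`oppFace_vN_zero/two`),
  and the explicit five-bond re-linking core `ζN` (strand `oppFace vN 1 → y_4`, strand `y_0 → y_1`; finite facts `closed_cN0/1/2`,
  `not_xiLinked_N`, `parity_N`, `isCoreb_ζN` by `decide`).
* `§ NecessityFive` — ★ `pictureCount_vN_support`: at `vN` only the two pictures `picA = (3,4,2; {0,1})` and `picB = (3,1,2; {4,0})` can be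
  counted (corner sides + `tripodPicture_five`), so ★ `face_relation_vN`: for every weight holomorphic on `hexBall2Near`,
  `c_A·τ²·δ_0 + c_B·τ⁴·δ_4 = 0`, with `(c_A, c_B) ≠ (0,0)` (`pictureCount_vN_ne_zero`, from `ζN`); transporting by the five rotations gives the
  two-term recurrence `A·δ_{c+1} + B·δ_c = 0` around `ℤ/5` with `A⁵ + B⁵ = τ·(c_A⁵ + τ c_B⁵) ≠ 0`, whence ★★★
  `classDefect_eq_zero_of_forall_holomorphicW`, `tripodLaw_of_forall_holomorphicW_five` and ★★★★ `tripodLaw_iff_forall_holomorphicW_five`: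
  **for five disorders, TRIPOD LAW ⟺ DISCRETE HOLOMORPHICITY ON EVERY FIVE-MARKED DOMAIN.** No census of cores is needed: one core, two
  corner sides and the cyclic symmetry replace the rank computation.
* `§ OneDomain` — `holomorphicW_rotate_iterate_iff`; ★★★ `classDefect_eq_zero_of_holomorphicW_rotates` / `tripodLaw_iff_holomorphicW_rotates`:
  FIVE DOMAINS SUFFICE — the tripod law ⟺ holomorphicity on the five rotations (relabellings) of the witness hexagon.
* `§ ClassificationFive` — in Khristoforov–Smirnov's own terms: `const_relations_five_iff`, ★★★ `holomorphic_const_iff_five` — an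
  `L`-INDEPENDENT weight `j ↦ c_j` (an observable `Σ_j c_j H_j` built from the link CLASSES only) is discretely holomorphic on every
  five-marked domain iff it is CONSTANT: at five disorders there is no class-only analogue of `F = Σ_j τ^j H_j`; holomorphic observables
  must weigh the link pattern (as the fan weight does).

The converse direction is the lane's statement (Khristoforov–Smirnov prove sufficiency, Lemma 4); the witness domain and the recurrence
argument are written here for the lane, not taken from a source.

## References
* M. Khristoforov, S. Smirnov, *Percolation and O(1) loop model*, arXiv:2111.15612 (2021), §1.2 (arXiv v1 p. 2: loop configurations with `k`
  disorders, «IP(ξ) is a union of disjoint paths, matching marked points», cyclic indexing), §2 Definition 3 and Lemma 4 with its proof and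
  Fig. 3 (p. 4: «each triple contributes zero»).
* B. Bollobás, O. Riordan, *Percolation*, Cambridge University Press (2006), Ch. 7 §7.2.2 (pp. 191–195: marked discrete domains, the marked
  hexagon), Lemma 12 (pp. 206–207: faces and opposite faces), §7.2.3 p. 197 (re-marking by relabelling).

## Mathlib / tree
Tree: `MarkedLoopHolomorphicDefect.lean` (`tripodDefect`, `tripodDefect_rotate`, `PicIdx`, `defectAt`, `HasPicture`, `pictureCount`,
`hasPicture_iff_eq`, `holomorphicW_iff_sum_pictureCount`, `tripodPicture_of_pictureCount_ne_zero`, `holomorphicW_of_tripodLaw'`, `IsRelinking`),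
`MarkedLoopRotation.lean` (`rot`, `rotW`, `relMap`, `relMap_withPair`, `holomorphicW_rotate_iff`), `MarkedLoopHolomorphy.lean` (`TripodPicture`,
`TripodLaw`, `CcwTriple`, `CcwQuad`, `withPair`, `mem_withPair`, `HolomorphicW`, `hbK_core_partners`, `eq_partner_of_linked`),
`KhSThreeDisorderObservable.lean` (`AllSides`, `IsCoreb`, `coreSetb`, `Eminus`), `TriHexBallDomain.lean` (`hexBall2Five`, `hexBall2Base`),
`MarkedLoopSpace.lean` (`IsCornerFace`, `isCornerFace_iff_eq_yc`, `mem_hBonds`, `corners`). Mathlib: `finRotate`, `Fintype.sum_eq_add`,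
`Function.iterate_succ_apply'`, `Fin.cast_val_eq_self` (scoped `Fin.NatCast`), `IsPrimitiveRoot.geom_sum_eq_zero`, `decide`.
-/

open Finset

namespace Literature.Probability.Percolation.MarkedLoops

open Literature.Probability.Percolation Literature.Probability.LatticeModels
open Literature.Probability.Percolation.FivePoint (tau XiLinked xiDeg side)
open Literature.Probability.Percolation.FivePoint.N5 (xiLinked_iff_reachable)
open TriMarkedDomain

/-! ### Five marks: the tripod pictures are the fifteen readings of five classes -/
section Five

/-- `τ² + τ + 1 = 0`. [folklore] -/
private theorem tau_sum₅ : 1 + tau + tau ^ 2 = 0 := by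
  have hprim : IsPrimitiveRoot tau 3 := by
    have h := Complex.isPrimitiveRoot_exp 3 (by norm_num)
    unfold tau
    convert h using 2
    push_cast
    ring
  have h := hprim.geom_sum_eq_zero (by norm_num : 1 < 3)
  simp only [Finset.sum_range_succ, Finset.sum_range_zero, pow_zero, pow_one, zero_add] at h
  linear_combination h

/-- `τ³ = 1`. [folklore] -/
private theorem tau_cube₅ : tau ^ 3 = 1 := by linear_combination (tau - 1) * tau_sum₅

/-- `τ ≠ 0`. [folklore] -/
private theorem tau_ne_zero₅ : tau ≠ 0 := fun h => by
  have := tau_cube₅; rw [h] at this; norm_num at this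

/-- the relation linking the two adjacent corners `c, c+1` (and nothing else). [cite: KhristoforovSmirnov2021, §1.2 (arXiv v1 p. 2: link patterns)] -/
def pairRel (c : Fin 5) : Finset (Fin 5 × Fin 5) := withPair ∅ c (c + 1)

/-- **the CLASS DEFECT** `δ_c(wt)` at five marks: the tripod defect of the picture «`y_c` linked to `y_{c+1}`, the neighbours of the
vertex linked to `y_{c+2}, y_{c+3}, y_{c+4}`», read from the corner `c+2`. [cite: KhristoforovSmirnov2021, §2 Lemma 4, proof and Fig. 3 (p. 4)] -/
noncomputable def classDefect (wt : Fin 5 → Finset (Fin 5 × Fin 5) → ℂ) (c : Fin 5) : ℂ :=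
  tripodDefect wt (c + 2) (c + 3) (c + 4) (pairRel c)

/-- the ten three-subsets of `ℤ/5`, read anticlockwise: five CONSECUTIVE triples `{c+2, c+3, c+4}` and five of shape `{c, c+1, c+3}`. [folklore] -/
private theorem ccw_five_shape : ∀ α β γ : Fin 5, CcwTriple α β γ → ∃ c : Fin 5,
    (α = c + 2 ∧ β = c + 3 ∧ γ = c + 4 ∨ α = c + 3 ∧ β = c + 4 ∧ γ = c + 2 ∨ α = c + 4 ∧ β = c + 2 ∧ γ = c + 3) ∨
    (α = c ∧ β = c + 1 ∧ γ = c + 3 ∨ α = c + 1 ∧ β = c + 3 ∧ γ = c ∨ α = c + 3 ∧ β = c ∧ γ = c + 1) := by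
  unfold CcwTriple; decide

/-- the two points off a consecutive triple. [folklore] -/
private theorem off_consecutive : ∀ c b : Fin 5, b ≠ c + 2 → b ≠ c + 3 → b ≠ c + 4 → b = c ∨ b = c + 1 := by decide

/-- the two points off a triple of the second shape. [folklore] -/
private theorem off_gapped : ∀ c b : Fin 5, b ≠ c → b ≠ c + 1 → b ≠ c + 3 → b = c + 2 ∨ b = c + 4 := by decide

/-- small facts in `ℤ/5`. [folklore] -/
private theorem fin5_facts : ∀ c : Fin 5, c ≠ c + 1 ∧ c + 2 ≠ c + 4 ∧ CcwQuad (c + 1) (c + 2) (c + 3) (c + 4) := by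
  unfold CcwQuad; decide

/-- `withPair ∅ a b` is the symmetric pair. [folklore] -/
private theorem mem_withPair_empty {a b x y : Fin 5} : (x, y) ∈ withPair ∅ a b ↔ x = a ∧ y = b ∨ x = b ∧ y = a := by
  rw [mem_withPair]
  simp only [Finset.notMem_empty, or_false]

/-- the chords of the triple lie in the augmented relation. [folklore] -/
private theorem chord_mem (L₀ : Finset (Fin 5 × Fin 5)) (α β γ p q : Fin 5)
    (h : p = α ∧ q = β ∨ p = β ∧ q = α ∨ p = β ∧ q = γ ∨ p = γ ∧ q = β ∨ p = γ ∧ q = α ∨ p = α ∧ q = γ) :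
    (p, q) ∈ withPair (withPair (withPair L₀ α β) β γ) γ α := by
  rw [mem_withPair, mem_withPair, mem_withPair]; tauto

/-- ★ **THE TRIPOD PICTURES AT FIVE MARKS**: a tripod picture `(α, β, γ; L₀)` on five corners is one of the three anticlockwise
readings of a triple `(c+2, c+3, c+4)` with `L₀` the single pair `{c, c+1}` (planarity: the two remaining corners are adjacent).
[cite: KhristoforovSmirnov2021, §2 Lemma 4, proof and Fig. 3 (p. 4); §1.2 (p. 2: «IP(ξ) is a union of disjoint paths, matching marked points»)] -/
theorem tripodPicture_five {α β γ : Fin 5} {L₀ : Finset (Fin 5 × Fin 5)} (h : TripodPicture α β γ L₀) :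
    ∃ c : Fin 5, L₀ = pairRel c ∧
      (α = c + 2 ∧ β = c + 3 ∧ γ = c + 4 ∨ α = c + 3 ∧ β = c + 4 ∧ γ = c + 2 ∨ α = c + 4 ∧ β = c + 2 ∧ γ = c + 3) := by
  obtain ⟨c, hread | hbad⟩ := ccw_five_shape α β γ h.ccw
  · -- consecutive: the other corners are `c, c+1`, and `L₀` links them
    refine ⟨c, ?_, hread⟩
    have hoffαβγ : ∀ b : Fin 5, b ≠ α → b ≠ β → b ≠ γ → b = c ∨ b = c + 1 := by
      intro b h1 h2 h3
      rcases hread with ⟨hα, hβ, hγ⟩ | ⟨hα, hβ, hγ⟩ | ⟨hα, hβ, hγ⟩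
      · exact off_consecutive c b (hα ▸ h1) (hβ ▸ h2) (hγ ▸ h3)
      · exact off_consecutive c b (hγ ▸ h3) (hα ▸ h1) (hβ ▸ h2)
      · exact off_consecutive c b (hβ ▸ h2) (hγ ▸ h3) (hα ▸ h1)
    have hcα : c ≠ α ∧ c ≠ β ∧ c ≠ γ := by
      have key : ∀ c : Fin 5, c ≠ c + 2 ∧ c ≠ c + 3 ∧ c ≠ c + 4 := by decide
      obtain ⟨k2, k3, k4⟩ := key c
      rcases hread with ⟨hα, hβ, hγ⟩ | ⟨hα, hβ, hγ⟩ | ⟨hα, hβ, hγ⟩ <;> subst hα hβ hγ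
      · exact ⟨k2, k3, k4⟩
      · exact ⟨k3, k4, k2⟩
      · exact ⟨k4, k2, k3⟩
    obtain ⟨b, hb, -⟩ := h.perfect c hcα.1 hcα.2.1 hcα.2.2
    obtain ⟨hbα, hbβ, hbγ⟩ := h.off _ _ (h.symm _ _ hb)
    have hb1 : b = c + 1 := by
      rcases hoffαβγ b hbα hbβ hbγ with hbc | hbc
      · rw [hbc] at hb; exact absurd hb (h.irrefl c)
      · exact hbc
    rw [hb1] at hb
    ext ⟨u, w⟩
    unfold pairRel
    rw [mem_withPair_empty]
    constructor
    · intro huw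
      obtain ⟨huα, huβ, huγ⟩ := h.off _ _ huw
      obtain ⟨hwα, hwβ, hwγ⟩ := h.off _ _ (h.symm _ _ huw)
      have hne : u ≠ w := fun e => h.irrefl u (e ▸ huw)
      rcases hoffαβγ u huα huβ huγ with hu | hu <;> rcases hoffαβγ w hwα hwβ hwγ with hw | hw
      · exact absurd (hu.trans hw.symm) hne
      · exact Or.inl ⟨hu, hw⟩
      · exact Or.inr ⟨hu, hw⟩
      · exact absurd (hu.trans hw.symm) hne
    · rintro (⟨rfl, rfl⟩ | ⟨rfl, rfl⟩)
      · exact hb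
      · exact h.symm _ _ hb
  · -- the second shape is not planar: `c+2 ~ c+4` crosses the chord `(c+1, c+3)`
    exfalso
    obtain ⟨hc1, hc24, hquad⟩ := fin5_facts c
    have hoffαβγ : ∀ b : Fin 5, b ≠ α → b ≠ β → b ≠ γ → b = c + 2 ∨ b = c + 4 := by
      intro b h1 h2 h3
      rcases hbad with ⟨hα, hβ, hγ⟩ | ⟨hα, hβ, hγ⟩ | ⟨hα, hβ, hγ⟩
      · exact off_gapped c b (hα ▸ h1) (hβ ▸ h2) (hγ ▸ h3)
      · exact off_gapped c b (hγ ▸ h3) (hα ▸ h1) (hβ ▸ h2)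
      · exact off_gapped c b (hβ ▸ h2) (hγ ▸ h3) (hα ▸ h1)
    have hc2 : c + 2 ≠ α ∧ c + 2 ≠ β ∧ c + 2 ≠ γ := by
      have key : ∀ c : Fin 5, c + 2 ≠ c ∧ c + 2 ≠ c + 1 ∧ c + 2 ≠ c + 3 := by decide
      obtain ⟨k0, k1, k3⟩ := key c
      rcases hbad with ⟨hα, hβ, hγ⟩ | ⟨hα, hβ, hγ⟩ | ⟨hα, hβ, hγ⟩ <;> subst hα hβ hγ
      · exact ⟨k0, k1, k3⟩
      · exact ⟨k1, k3, k0⟩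
      · exact ⟨k3, k0, k1⟩
    obtain ⟨b, hb, -⟩ := h.perfect (c + 2) hc2.1 hc2.2.1 hc2.2.2
    obtain ⟨hbα, hbβ, hbγ⟩ := h.off _ _ (h.symm _ _ hb)
    have hb4 : b = c + 4 := by
      rcases hoffαβγ b hbα hbβ hbγ with hbc | hbc
      · rw [hbc] at hb; exact absurd hb (h.irrefl _)
      · exact hbc
    rw [hb4] at hb
    have hchord : (c + 1, c + 3) ∈ withPair (withPair (withPair L₀ α β) β γ) γ α := by
      apply chord_mem
      rcases hbad with ⟨hα, hβ, hγ⟩ | ⟨hα, hβ, hγ⟩ | ⟨hα, hβ, hγ⟩ <;> subst hα hβ hγ <;> tauto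
    exact h.planar _ _ _ _ hchord hb hquad

/-- conversely every class representative is a tripod picture. [cite: KhristoforovSmirnov2021, §2 Lemma 4, proof and Fig. 3 (p. 4)] -/
theorem tripodPicture_classRep (c : Fin 5) : TripodPicture (c + 2) (c + 3) (c + 4) (pairRel c) := by
  have hccw : ∀ c : Fin 5, CcwTriple (c + 2) (c + 3) (c + 4) := by unfold CcwTriple; decide
  have hoff : ∀ c a : Fin 5, (a = c ∨ a = c + 1) → a ≠ c + 2 ∧ a ≠ c + 3 ∧ a ≠ c + 4 := by decide
  have hperf : ∀ c a : Fin 5, a ≠ c + 2 → a ≠ c + 3 → a ≠ c + 4 → a = c ∨ a = c + 1 := by decide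
  have hne : ∀ c : Fin 5, c ≠ c + 1 := by decide
  have hplanar : ∀ c x y z w : Fin 5,
      (x = c + 4 ∧ z = c + 2 ∨ x = c + 2 ∧ z = c + 4 ∨ x = c + 3 ∧ z = c + 4 ∨ x = c + 4 ∧ z = c + 3 ∨
        x = c + 2 ∧ z = c + 3 ∨ x = c + 3 ∧ z = c + 2 ∨ x = c ∧ z = c + 1 ∨ x = c + 1 ∧ z = c) →
      (y = c ∧ w = c + 1 ∨ y = c + 1 ∧ w = c) → ¬ CcwQuad x y z w := by
    unfold CcwQuad; decide
  refine ⟨hccw c, fun a b hab => ?_, fun a haa => ?_, fun a b hab => ?_, fun a h2 h3 h4 => ?_, fun x y z w hxz hyw => ?_⟩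
  · unfold pairRel at hab ⊢; rw [mem_withPair_empty] at hab ⊢; tauto
  · unfold pairRel at haa; rw [mem_withPair_empty] at haa
    rcases haa with ⟨h1, h2⟩ | ⟨h1, h2⟩
    · exact hne c (h1.symm.trans h2)
    · exact hne c (h2.symm.trans h1)
  · unfold pairRel at hab; rw [mem_withPair_empty] at hab
    rcases hab with ⟨ha, -⟩ | ⟨ha, -⟩
    · exact hoff c a (Or.inl ha)
    · exact hoff c a (Or.inr ha)
  · rcases hperf c a h2 h3 h4 with ha | ha
    · refine ⟨c + 1, ?_, fun b hb => ?_⟩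
      · show (a, c + 1) ∈ pairRel c
        unfold pairRel; rw [mem_withPair_empty]; exact Or.inl ⟨ha, rfl⟩
      · have hb' : (a, b) ∈ pairRel c := hb
        unfold pairRel at hb'; rw [mem_withPair_empty] at hb'
        rcases hb' with ⟨-, h2⟩ | ⟨h1, h2⟩
        · exact h2
        · exact absurd (ha.symm.trans h1) (hne c)
    · refine ⟨c, ?_, fun b hb => ?_⟩
      · show (a, c) ∈ pairRel c
        unfold pairRel; rw [mem_withPair_empty]; exact Or.inr ⟨ha, rfl⟩
      · have hb' : (a, b) ∈ pairRel c := hb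
        unfold pairRel at hb'; rw [mem_withPair_empty] at hb'
        rcases hb' with ⟨h1, h2⟩ | ⟨-, h2⟩
        · exact absurd (ha.symm.trans h1).symm (hne c)
        · exact h2
  · unfold pairRel at hxz hyw
    rw [mem_withPair, mem_withPair, mem_withPair, mem_withPair_empty] at hxz
    rw [mem_withPair_empty] at hyw
    exact hplanar c x y z w hxz hyw

/-- the defect of a reading of class `c` is a cube root of unity times the class defect.
[cite: KhristoforovSmirnov2021, §2 Lemma 4, proof and Fig. 3 (p. 4)] -/
theorem tripodDefect_eq_classDefect (wt : Fin 5 → Finset (Fin 5 × Fin 5) → ℂ) {α β γ : Fin 5} {c : Fin 5}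
    (h : α = c + 2 ∧ β = c + 3 ∧ γ = c + 4 ∨ α = c + 3 ∧ β = c + 4 ∧ γ = c + 2 ∨ α = c + 4 ∧ β = c + 2 ∧ γ = c + 3) :
    ∃ r : ℕ, tripodDefect wt α β γ (pairRel c) = tau ^ r * classDefect wt c := by
  unfold classDefect
  rcases h with ⟨rfl, rfl, rfl⟩ | ⟨rfl, rfl, rfl⟩ | ⟨rfl, rfl, rfl⟩
  · exact ⟨0, by rw [pow_zero, one_mul]⟩
  · exact ⟨2, tripodDefect_rotate wt _ _ _ _⟩
  · exact ⟨4, by rw [tripodDefect_rotate, tripodDefect_rotate, ← mul_assoc, ← pow_add]⟩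

/-- ★ **THE TRIPOD LAW AT FIVE MARKS IS FIVE RELATIONS**: `TripodLaw wt ↔ δ_c(wt) = 0` for the five classes `c`.
[cite: KhristoforovSmirnov2021, §2 Lemma 4, proof and Fig. 3 (p. 4)] -/
theorem tripodLaw_five_iff (wt : Fin 5 → Finset (Fin 5 × Fin 5) → ℂ) : TripodLaw wt ↔ ∀ c : Fin 5, classDefect wt c = 0 := by
  rw [tripodLaw_iff_tripodDefect]
  constructor
  · intro h c
    exact h _ _ _ _ (tripodPicture_classRep c)
  · intro h α β γ L₀ hP
    obtain ⟨c, rfl, hread⟩ := tripodPicture_five hP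
    obtain ⟨r, hr⟩ := tripodDefect_eq_classDefect wt hread
    rw [hr, h c, mul_zero]

/-! ### Rotation of the marks shifts the classes -/

/-- the defect of the transported weight. [cite: KhristoforovSmirnov2021, §2 Lemma 4 (p. 4); §1.2 (p. 2: cyclic indexing)] -/
theorem tripodDefect_rotW {nm : ℕ} (σ : Equiv.Perm (Fin nm)) (wt : Fin nm → Finset (Fin nm × Fin nm) → ℂ) (α β γ : Fin nm)
    (L₀ : Finset (Fin nm × Fin nm)) :
    tripodDefect (rotW σ wt) α β γ L₀ = tripodDefect wt (σ α) (σ β) (σ γ) (relMap σ L₀) := by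
  unfold tripodDefect rotW
  rw [relMap_withPair, relMap_withPair, relMap_withPair]

/-- the image of the empty relation is empty. [folklore] -/
private theorem relMap_empty {nm : ℕ} (σ : Equiv.Perm (Fin nm)) : relMap σ (∅ : Finset (Fin nm × Fin nm)) = ∅ := by
  unfold relMap; exact Finset.map_empty _

/-- **back-rotating the marks shifts the class index**: `δ_c(rot⁻¹·wt) = δ_{c−1}(wt)`.
[cite: KhristoforovSmirnov2021, §1.2 (arXiv v1 p. 2: marked points indexed cyclically); §2 Lemma 4 (p. 4)] -/
theorem classDefect_rotW_symm (wt : Fin 5 → Finset (Fin 5 × Fin 5) → ℂ) (c : Fin 5) :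
    classDefect (rotW (rot 5).symm wt) c = classDefect wt (c - 1) := by
  unfold classDefect pairRel
  rw [tripodDefect_rotW, relMap_withPair, relMap_empty]
  simp only [finRotate_symm_apply]
  have e : ∀ c : Fin 5, c + 2 - 1 = c - 1 + 2 ∧ c + 3 - 1 = c - 1 + 3 ∧ c + 4 - 1 = c - 1 + 4 ∧ c + 1 - 1 = c - 1 + 1 := by decide
  obtain ⟨e2, e3, e4, e1⟩ := e c
  rw [e2, e3, e4, e1]

/-- the everywhere-holomorphic weights are stable under back-rotation of the marks (apply the hypothesis to the ROTATED domain).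
[cite: KhristoforovSmirnov2021, §2 Lemma 4 eq. (3) (p. 4); BollobasRiordan2006, Ch. 7 §7.2.3 p. 197 (re-marking by relabelling)] -/
theorem forall_holomorphicW_rotW_symm {wt : Fin 5 → Finset (Fin 5 × Fin 5) → ℂ} (h : ∀ D : TriMarkedDomain 5, HolomorphicW D wt) :
    ∀ D : TriMarkedDomain 5, HolomorphicW D (rotW (rot 5).symm wt) := fun D =>
  (holomorphicW_rotate_iff D wt).1 (h D.rotate)

/-- iterating: the `m`-fold back-rotation stays everywhere holomorphic … [cite: KhristoforovSmirnov2021, §2 Lemma 4 eq. (3) (p. 4)] -/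
theorem forall_holomorphicW_iterate {wt : Fin 5 → Finset (Fin 5 × Fin 5) → ℂ} (h : ∀ D : TriMarkedDomain 5, HolomorphicW D wt)
    (m : ℕ) : ∀ D : TriMarkedDomain 5, HolomorphicW D ((rotW (rot 5).symm)^[m] wt) := by
  induction m with
  | zero => exact h
  | succ m ih => rw [Function.iterate_succ_apply']; exact forall_holomorphicW_rotW_symm ih

open Fin.NatCast in
/-- … and shifts the class index by `m`. [cite: KhristoforovSmirnov2021, §2 Lemma 4 (p. 4)] -/
theorem classDefect_iterate (wt : Fin 5 → Finset (Fin 5 × Fin 5) → ℂ) (m : ℕ) (c : Fin 5) :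
    classDefect ((rotW (rot 5).symm)^[m] wt) c = classDefect wt (c - (m : Fin 5)) := by
  induction m generalizing c with
  | zero => rw [Function.iterate_zero_apply, Nat.cast_zero, sub_zero]
  | succ m ih =>
    rw [Function.iterate_succ_apply', classDefect_rotW_symm, ih, Nat.cast_succ, sub_sub, add_comm]

/-! ### The elimination: a two-term relation around the five classes forces all class defects to vanish -/

/-- ★ a two-term recurrence `A·δ(c+1) + B·δ(c) = 0` around `ℤ/5` with `A⁵ + B⁵ ≠ 0` has only the zero solution.
[cite: KhristoforovSmirnov2021, §1.2 (arXiv v1 p. 2: the marked points are indexed cyclically)] -/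
theorem cyclic_elim_five {A B : ℂ} {δ : Fin 5 → ℂ} (h : ∀ c : Fin 5, A * δ (c + 1) + B * δ c = 0) (hAB : A ^ 5 + B ^ 5 ≠ 0) :
    ∀ c : Fin 5, δ c = 0 := by
  intro c
  have h0 := h c
  have h1 := h (c + 1)
  have h2 := h (c + 1 + 1)
  have h3 := h (c + 1 + 1 + 1)
  have h4 := h (c + 1 + 1 + 1 + 1)
  have e5all : ∀ c : Fin 5, c + 1 + 1 + 1 + 1 + 1 = c := by decide
  have e5 := e5all c
  rw [e5] at h4
  have key : (A ^ 5 + B ^ 5) * δ c = 0 := by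
    linear_combination B ^ 4 * h0 - A * B ^ 3 * h1 + A ^ 2 * B ^ 2 * h2 - A ^ 3 * B * h3 + A ^ 4 * h4
  exact (mul_eq_zero.1 key).resolve_left hAB

/-- `τ` is not real. [folklore] -/
private theorem tau_im_ne_zero₅ : tau.im ≠ 0 := by
  intro h0
  have hre := congrArg Complex.re tau_sum₅
  simp only [Complex.add_re, Complex.one_re, sq, Complex.mul_re, h0, mul_zero, sub_zero, Complex.zero_re] at hre
  nlinarith [sq_nonneg (tau.re + 1 / 2)]

/-- for naturals `m, n` not both zero, `(m τ²)⁵ + (n τ⁴)⁵ = τ·(m⁵ + τ n⁵) ≠ 0` (`τ` is not real).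
[cite: KhristoforovSmirnov2021, §2 Definition 3 (p. 4: `τ = e^{2πi/3}`)] -/
theorem pow_five_add_ne_zero {m n : ℕ} (h : m ≠ 0 ∨ n ≠ 0) :
    ((m : ℂ) * tau ^ 2) ^ 5 + ((n : ℂ) * tau ^ 4) ^ 5 ≠ 0 := by
  have h3 := tau_cube₅
  have hτ : ((m : ℂ) * tau ^ 2) ^ 5 + ((n : ℂ) * tau ^ 4) ^ 5 = tau * ((m : ℂ) ^ 5 + tau * (n : ℂ) ^ 5) := by
    linear_combination ((m : ℂ) ^ 5 * (tau ^ 6 + tau ^ 3 + 1) * tau + (n : ℂ) ^ 5 * tau ^ 2 *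
      (tau ^ 15 + tau ^ 12 + tau ^ 9 + tau ^ 6 + tau ^ 3 + 1)) * h3
  rw [hτ]
  refine mul_ne_zero tau_ne_zero₅ fun h0 => ?_
  rw [← Nat.cast_pow, ← Nat.cast_pow] at h0
  have him := congrArg Complex.im h0
  have hre := congrArg Complex.re h0
  simp only [Complex.add_im, Complex.mul_im, Complex.natCast_im, Complex.natCast_re, mul_zero, zero_add, Complex.zero_im] at him
  simp only [Complex.add_re, Complex.mul_re, Complex.natCast_im, Complex.natCast_re, mul_zero, sub_zero, Complex.zero_re] at hre
  have hn : ((n ^ 5 : ℕ) : ℝ) = 0 := (mul_eq_zero.1 him).resolve_left tau_im_ne_zero₅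
  have hn0 : n = 0 := by
    have : n ^ 5 = 0 := by exact_mod_cast hn
    exact (pow_eq_zero_iff (by norm_num)).1 this
  have hm0 : m = 0 := by
    rw [hn0] at hre
    simp only [ne_eq, OfNat.ofNat_ne_zero, not_false_eq_true, zero_pow, Nat.cast_zero, mul_zero, add_zero] at hre
    have : m ^ 5 = 0 := by exact_mod_cast hre
    exact (pow_eq_zero_iff (by norm_num)).1 this
  rcases h with h | h
  · exact h hm0
  · exact h hn0

end Five

/-! ### Every number of marks: a neighbour that is a corner is read at its own position -/
section CornerSide

variable {nm : ℕ} {D : TriMarkedDomain nm}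

/-- ★ if the neighbour of `v` across side `i` IS the corner face `y_a`, every picture counted at `v` reads `a` at position `i` (a corner
neighbour is its own partner). [cite: KhristoforovSmirnov2021, §2 Lemma 4, proof and Fig. 3 (p. 4)] -/
theorem hasPicture_corner_side {v : HexVertex} (hv : AllSides D v) {i : Fin 3} {a : Fin nm} (ha : oppFace v i = yc D a)
    {q : Finset (Fin 3) × Finset (Sym2 (Site 2))} (hq : q ∈ coreSetb D v) {P : PicIdx nm} (hP : HasPicture D v q P) :
    (i = 0 → P.1 = a) ∧ (i = 1 → P.2.1 = a) ∧ (i = 2 → P.2.2.1 = a) := by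
  classical
  have hcore : IsCoreb D v q.1 q.2 := by
    unfold coreSetb at hq
    exact (Finset.mem_filter.1 hq).2
  obtain ⟨⟨hS, hnl⟩, h0, h1, h2, -⟩ := hP
  obtain ⟨S, ζ⟩ := q
  simp only at hS hnl hcore h0 h1 h2
  subst hS
  choose p hp using hbK_core_partners hv hcore hnl
  have ea : a = p i := eq_partner_of_linked hv hcore hp ((xiLinked_iff_reachable _ _ _).2 (by rw [ha]))
  refine ⟨?_, ?_, ?_⟩ <;> rintro rfl
  · exact (eq_partner_of_linked hv hcore hp h0).trans ea.symm
  · exact (eq_partner_of_linked hv hcore hp h1).trans ea.symm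
  · exact (eq_partner_of_linked hv hcore hp h2).trans ea.symm

/-- the case `i = 0`: the FIRST entry of every counted picture is `a`. [cite: KhristoforovSmirnov2021, §2 Lemma 4, proof and Fig. 3 (p. 4)] -/
theorem picFst_eq_of_corner_side {v : HexVertex} (hv : AllSides D v) {a : Fin nm} (ha : oppFace v 0 = yc D a)
    {q : Finset (Fin 3) × Finset (Sym2 (Site 2))} (hq : q ∈ coreSetb D v) {P : PicIdx nm} (hP : HasPicture D v q P) : P.1 = a :=
  (hasPicture_corner_side hv ha hq hP).1 rfl

/-- the case `i = 1`: the SECOND entry of every counted picture is `a`. [cite: KhristoforovSmirnov2021, §2 Lemma 4, proof and Fig. 3 (p. 4)] -/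
theorem picSnd_eq_of_corner_side {v : HexVertex} (hv : AllSides D v) {a : Fin nm} (ha : oppFace v 1 = yc D a)
    {q : Finset (Fin 3) × Finset (Sym2 (Site 2))} (hq : q ∈ coreSetb D v) {P : PicIdx nm} (hP : HasPicture D v q P) : P.2.1 = a :=
  (hasPicture_corner_side hv ha hq hP).2.1 rfl

/-- the case `i = 2`: the THIRD entry of every counted picture is `a`. [cite: KhristoforovSmirnov2021, §2 Lemma 4, proof and Fig. 3 (p. 4)] -/
theorem picThd_eq_of_corner_side {v : HexVertex} (hv : AllSides D v) {a : Fin nm} (ha : oppFace v 2 = yc D a)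
    {q : Finset (Fin 3) × Finset (Sym2 (Site 2))} (hq : q ∈ coreSetb D v) {P : PicIdx nm} (hP : HasPicture D v q P) : P.2.2.1 = a :=
  (hasPicture_corner_side hv ha hq hP).2.2 rfl

/-- a counted picture comes from a core in `coreSetb` carrying it. [cite: KhristoforovSmirnov2021, §2 Lemma 4, proof and Fig. 3 (p. 4)] -/
theorem exists_hasPicture_of_pictureCount_ne_zero {v : HexVertex} {P : PicIdx nm} (h : pictureCount D v P ≠ 0) :
    ∃ q ∈ coreSetb D v, HasPicture D v q P := by
  classical
  unfold pictureCount at h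
  obtain ⟨q, hq⟩ := Finset.card_pos.1 (Nat.pos_of_ne_zero h)
  rw [Finset.mem_filter] at hq
  exact ⟨q, hq.1, hq.2⟩

/-- a re-linking core makes the count of ITS picture non-zero. [cite: KhristoforovSmirnov2021, §2 Lemma 4, proof and Fig. 3 (p. 4)] -/
theorem pictureCount_ne_zero_of_core {v : HexVertex} (hv : AllSides D v) {ζ : Finset (Sym2 (Site 2))} (hq : IsCoreb D v Finset.univ ζ)
    (hnl : ∀ i i' : Fin 3, i ≠ i' → ¬ XiLinked ζ (oppFace v i) (oppFace v i')) {p : Fin 3 → Fin nm}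
    (hp : ∀ i : Fin 3, XiLinked ζ (oppFace v i) (yc D (p i))) : pictureCount D v (p 0, p 1, p 2, linkRel D ζ) ≠ 0 := by
  classical
  unfold pictureCount
  rw [Finset.card_ne_zero]
  refine ⟨(Finset.univ, ζ), Finset.mem_filter.2 ⟨?_, (hasPicture_iff_eq hv hq hnl hp _).2 rfl⟩⟩
  unfold coreSetb
  rw [Finset.mem_filter]
  exact ⟨Finset.mem_product.2 ⟨Finset.mem_univ _, Finset.mem_powerset.2 hq.1⟩, hq⟩

end CornerSide

end Literature.Probability.Percolation.MarkedLoops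

/-! ## The witness domain: the hexagon of radius 2 marked at five NEARBY boundary sites -/

noncomputable section

namespace Literature.Probability.Percolation

open LatticeModels

set_option maxRecDepth 400000

/-- the positions of the five marked darts along the 30-dart boundary cycle of `triBall 2` (based at `hexBall2Base`): the boundary sites
`(2,-1), (2,0), (1,1), (0,2), (-1,2)` — five CONSECUTIVE markable sites. [cite: BollobasRiordan2006, Ch. 7 §7.2.2 (pp. 191–195)] -/
def hexBall2NearPos : Fin 5 → ℕ := ![0, 2, 5, 7, 10]

/-- **the five-marked hexagon of radius 2 with nearby marks**: sites `triBall 2`, base dart `((2,-1),(3,-1))`, marks at positions `0, 2, 5, 7, 10`;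
the disc fields are those of `hexBall2Five` (same sites, same base), the mark fields by `decide`. [cite: BollobasRiordan2006, Ch. 7 §7.2.2 (pp. 191–195)] -/
def hexBall2Near : TriMarkedDomain 5 where
  verts := triBall 2
  base := hexBall2Base
  pos := hexBall2NearPos
  base_mem := hexBall2Five.base_mem
  connected := hexBall2Five.connected
  outer_connected := hexBall2Five.outer_connected
  no_cut := hexBall2Five.no_cut
  outer_no_cut := hexBall2Five.outer_no_cut
  euler := hexBall2Five.euler
  cycle := hexBall2Five.cycle
  cycle_len := hexBall2Five.cycle_len
  pos_zero := fun _ => rfl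
  pos_strictMono := by
    intro a b hab
    revert a b
    decide
  pos_lt := by decide
  mark_pred := by decide
  mark_pred_pred := by decide
  mark_injective := by
    intro a b hab
    revert a b
    decide

/-- the site set of `hexBall2Near` is `triBall 2`. [cite: BollobasRiordan2006, Ch. 7 §7.2.2 (pp. 191–195)] -/
@[simp] theorem hexBall2Near_verts : hexBall2Near.verts = triBall 2 := rfl

/-- the marked sites of `hexBall2Near`. [cite: BollobasRiordan2006, Ch. 7 §7.2.2 (pp. 191–195)] -/
theorem hexBall2Near_markSite :
    (hexBall2Near.markSite 0, hexBall2Near.markSite 1, hexBall2Near.markSite 2, hexBall2Near.markSite 3, hexBall2Near.markSite 4) =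
      (![2, -1], ![2, 0], ![1, 1], ![0, 2], ![-1, 2]) := by
  decide

end Literature.Probability.Percolation

end

namespace Literature.Probability.Percolation.MarkedLoops

open Literature.Probability.Percolation Literature.Probability.LatticeModels
open Literature.Probability.Percolation.FivePoint (tau XiLinked xiDeg side)
open Literature.Probability.Percolation.FivePoint.N5 (xiLinked_iff_reachable)
open TriMarkedDomain

/-! ### The witness face and core -/
section Witness

set_option maxRecDepth 400000

/-- the corner faces of `hexBall2Near`, tabulated. [cite: BollobasRiordan2006, Ch. 7 §7.2.2 (pp. 191–195)] -/
def cornerN : Fin 5 → HexVertex := ![(![2, -2], 1), (![2, -1], 1), (![1, 1], 0), (![0, 2], 0), (![-2, 2], 1)]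

/-- the tabulated faces ARE the corner faces. [cite: BollobasRiordan2006, Ch. 7 §7.2.2 (pp. 191–195)] -/
theorem isCornerFace_cornerN (j : Fin 5) : IsCornerFace hexBall2Near j (cornerN j) := by
  revert j
  unfold IsCornerFace predDart
  decide

/-- `yc hexBall2Near = cornerN`. [cite: BollobasRiordan2006, Ch. 7 §7.2.2 (pp. 191–195)] -/
theorem yc_hexBall2Near (j : Fin 5) : yc hexBall2Near j = cornerN j :=
  ((isCornerFace_iff_eq_yc hexBall2Near).1 (isCornerFace_cornerN j)).symm

/-- the witness face `v = ((0,1), down)`: its sides `0` and `2` are shared with the corner faces `y_3` and `y_2`.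
[cite: KhristoforovSmirnov2021, §2 Lemma 4 (p. 4)] -/
def vN : HexVertex := (![0, 1], 1)

/-- the witness core: five bonds — a 3-bond strand from `oppFace vN 1` to `y_4` and a 2-bond strand from `y_0` to `y_1`.
[cite: KhristoforovSmirnov2021, §2 Lemma 4, proof and Fig. 3 (p. 4)] -/
def ζN : Finset (Sym2 (Site 2)) :=
  {s(![0, 1], ![0, 2]), s(![-1, 2], ![0, 2]), s(![-1, 2], ![-1, 3]), s(![2, -1], ![3, -1]), s(![2, 0], ![3, -1])}

/-- the (trivial) component of `oppFace vN 0 = y_3`. [cite: KhristoforovSmirnov2021, §2 Lemma 4 (p. 4)] -/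
def cN0 : Finset HexVertex := {(![0, 2], 0)}
/-- the faces of the strand from `oppFace vN 1`. [cite: KhristoforovSmirnov2021, §2 Lemma 4 (p. 4)] -/
def cN1 : Finset HexVertex := {(![0, 1], 0), (![-1, 2], 0), (![-1, 1], 1), (![-2, 2], 1)}
/-- the (trivial) component of `oppFace vN 2 = y_2`. [cite: KhristoforovSmirnov2021, §2 Lemma 4 (p. 4)] -/
def cN2 : Finset HexVertex := {(![1, 1], 0)}

/-- the three neighbours of the witness face. [cite: BollobasRiordan2006, Ch. 7 Lemma 12 (pp. 206–207)] -/
theorem oppFace_vN : oppFace vN 0 = (![0, 2], 0) ∧ oppFace vN 1 = (![0, 1], 0) ∧ oppFace vN 2 = (![1, 1], 0) := by decide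

/-- the neighbour across side `0` is the corner face `y_3`. [cite: KhristoforovSmirnov2021, §2 Lemma 4 (p. 4)] -/
theorem oppFace_vN_zero : oppFace vN 0 = yc hexBall2Near 3 := by
  rw [yc_hexBall2Near, oppFace_vN.1]
  decide

/-- the neighbour across side `2` is the corner face `y_2`. [cite: KhristoforovSmirnov2021, §2 Lemma 4 (p. 4)] -/
theorem oppFace_vN_two : oppFace vN 2 = yc hexBall2Near 2 := by
  rw [yc_hexBall2Near, oppFace_vN.2.2]
  decide

/-- the first component is closed under adjacency across bonds of the core. [cite: KhristoforovSmirnov2021, §2 Lemma 4 (p. 4)] -/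
theorem closed_cN0 : ∀ F ∈ cN0, ∀ j : Fin 3, s(faceVertex F (j + 1), faceVertex F (j + 2)) ∈ ζN → oppFace F j ∈ cN0 := by decide
/-- the second component is closed. [cite: KhristoforovSmirnov2021, §2 Lemma 4 (p. 4)] -/
theorem closed_cN1 : ∀ F ∈ cN1, ∀ j : Fin 3, s(faceVertex F (j + 1), faceVertex F (j + 2)) ∈ ζN → oppFace F j ∈ cN1 := by decide
/-- the third component is closed. [cite: KhristoforovSmirnov2021, §2 Lemma 4 (p. 4)] -/
theorem closed_cN2 : ∀ F ∈ cN2, ∀ j : Fin 3, s(faceVertex F (j + 1), faceVertex F (j + 2)) ∈ ζN → oppFace F j ∈ cN2 := by decide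

/-- reachability stays inside a set closed under the step relation. [folklore] -/
private theorem reflTransGen_mem_of_closed' {α : Type*} {R : α → α → Prop} {C : Finset α}
    (hC : ∀ a ∈ C, ∀ b, R a b → b ∈ C) {a b : α} (ha : a ∈ C) (h : Relation.ReflTransGen R a b) : b ∈ C := by
  induction h with
  | refl => exact ha
  | tail _ hbc ih => exact hC _ ih _ hbc

/-- linking inside the core stays in the component. [cite: KhristoforovSmirnov2021, §2 Lemma 4 (p. 4)] -/
theorem xiLinked_mem_N {C : Finset HexVertex} (hC : ∀ F ∈ C, ∀ j : Fin 3, s(faceVertex F (j + 1), faceVertex F (j + 2)) ∈ ζN → oppFace F j ∈ C)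
    {Y Y' : HexVertex} (hY : Y ∈ C) (h : XiLinked ζN Y Y') : Y' ∈ C := by
  refine reflTransGen_mem_of_closed' (fun F hF F' hR => ?_) hY h
  obtain ⟨j, rfl, hj⟩ := hR
  exact hC F hF j hj

/-- no two neighbours of the witness face are linked in the witness core. [cite: KhristoforovSmirnov2021, §2 Lemma 4 (p. 4)] -/
theorem not_xiLinked_N : ∀ j j' : Fin 3, j ≠ j' → ¬ XiLinked ζN (oppFace vN j) (oppFace vN j') := by
  obtain ⟨h0, h1, h2⟩ := oppFace_vN
  have c0 := closed_cN0
  have c1 := closed_cN1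
  have c2 := closed_cN2
  have m0 : oppFace vN 0 ∈ cN0 := by rw [h0]; decide
  have m1 : oppFace vN 1 ∈ cN1 := by rw [h1]; decide
  have m2 : oppFace vN 2 ∈ cN2 := by rw [h2]; decide
  have n01 : oppFace vN 1 ∉ cN0 := by rw [h1]; decide
  have n02 : oppFace vN 2 ∉ cN0 := by rw [h2]; decide
  have n10 : oppFace vN 0 ∉ cN1 := by rw [h0]; decide
  have n12 : oppFace vN 2 ∉ cN1 := by rw [h2]; decide
  have n20 : oppFace vN 0 ∉ cN2 := by rw [h0]; decide
  have n21 : oppFace vN 1 ∉ cN2 := by rw [h1]; decide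
  intro j j' hjj' h
  have h3 : ∀ i : Fin 3, i = 0 ∨ i = 1 ∨ i = 2 := by decide
  rcases h3 j with rfl | rfl | rfl <;> rcases h3 j' with rfl | rfl | rfl
  · exact hjj' rfl
  · exact n01 (xiLinked_mem_N c0 m0 h)
  · exact n02 (xiLinked_mem_N c0 m0 h)
  · exact n10 (xiLinked_mem_N c1 m1 h)
  · exact hjj' rfl
  · exact n12 (xiLinked_mem_N c1 m1 h)
  · exact n20 (xiLinked_mem_N c2 m2 h)
  · exact n21 (xiLinked_mem_N c2 m2 h)
  · exact hjj' rfl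

/-- the witness bonds are edges of `H_G`. [cite: KhristoforovSmirnov2021, §1.2 (p. 2)] -/
theorem mem_hBonds_ζN : ∀ b ∈ ζN, b ∈ hBonds hexBall2Near := by
  intro b hb
  simp only [ζN, Finset.mem_insert, Finset.mem_singleton] at hb
  rcases hb with rfl | rfl | rfl | rfl | rfl
  · exact mem_hBonds hexBall2Near (by decide +kernel) (by decide +kernel)
  · exact mem_hBonds hexBall2Near (by decide +kernel) (by decide +kernel)
  · exact mem_hBonds hexBall2Near (by decide +kernel) (by decide +kernel)
  · exact mem_hBonds hexBall2Near (by decide +kernel) (by decide +kernel)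
  · exact mem_hBonds hexBall2Near (by decide +kernel) (by decide +kernel)

/-- the sides of the witness face, tabulated. [cite: BollobasRiordan2006, Ch. 7 Lemma 12 (pp. 206–207)] -/
theorem side_vN : side vN 0 = s(![1, 2], ![0, 2]) ∧ side vN 1 = s(![0, 2], ![1, 1]) ∧ side vN 2 = s(![1, 1], ![1, 2]) := by
  unfold side; decide

/-- the witness face has three `H_G`-sides (two of its three sites lie in the hexagon). [cite: KhristoforovSmirnov2021, §2 Lemma 4 (p. 4)] -/
theorem allSides_vN : AllSides hexBall2Near vN := by
  intro i
  have h3 : ∀ i : Fin 3, i = 0 ∨ i = 1 ∨ i = 2 := by decide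
  obtain ⟨e0, e1, e2⟩ := side_vN
  rcases h3 i with rfl | rfl | rfl
  · rw [e0]; exact mem_hBonds hexBall2Near (by decide +kernel) (by decide +kernel)
  · rw [e1]; exact mem_hBonds hexBall2Near (by decide +kernel) (by decide +kernel)
  · rw [e2]; exact mem_hBonds hexBall2Near (by decide +kernel) (by decide +kernel)

/-- the witness bonds avoid the sides of the witness face. [cite: KhristoforovSmirnov2021, §2 Lemma 4 (p. 4)] -/
theorem ζN_ne_side : ∀ b ∈ ζN, ∀ j : Fin 3, b ≠ side vN j := by unfold side; decide

/-- the parity profile of the witness core: odd faces = the corners `y_0, y_1, y_4` and the non-corner neighbour `oppFace vN 1`.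
[cite: KhristoforovSmirnov2021, §2 Lemma 4, proof and Fig. 3 (p. 4)] -/
theorem parity_N : ∀ F ∈ triFacesTouching (triBall 2), Odd (xiDeg ζN F) ↔
    F ∈ symmDiff ((Finset.univ : Finset (Fin 5)).image cornerN) ((Finset.univ : Finset (Fin 3)).image (oppFace vN)) := by
  have key : ∀ F ∈ triFacesTouching (triBall 2), (xiDeg ζN F % 2 = 1) ↔
      F ∈ symmDiff ((Finset.univ : Finset (Fin 5)).image cornerN) ((Finset.univ : Finset (Fin 3)).image (oppFace vN)) := by
    decide
  intro F hF
  rw [← key F hF, Nat.odd_iff]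

/-- the witness core IS a core at the witness face (all three neighbours odd-indexed).
[cite: KhristoforovSmirnov2021, §2 Lemma 4, proof and Fig. 3 (p. 4)] -/
theorem isCoreb_ζN : IsCoreb hexBall2Near vN Finset.univ ζN := by
  classical
  have hcorners : corners hexBall2Near = (Finset.univ : Finset (Fin 5)).image cornerN := by
    unfold corners
    exact Finset.image_congr fun t _ => yc_hexBall2Near t
  refine ⟨fun b hb => ?_, by decide, ?_⟩
  · unfold Eminus
    rw [Finset.mem_filter]
    exact ⟨mem_hBonds_ζN b hb, ζN_ne_side b hb⟩
  · intro F hF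
    rw [hcorners]
    exact parity_N F hF

end Witness

/-! ### Necessity at five marks -/
section NecessityFive

set_option maxRecDepth 400000

/-- the readings pinned by the two corner sides of the witness face: first entry `3`, third entry `2`. [folklore] -/
private theorem five_face_cases : ∀ c b : Fin 5,
    ((3 : Fin 5) = c + 2 ∧ b = c + 3 ∧ (2 : Fin 5) = c + 4 ∨ (3 : Fin 5) = c + 3 ∧ b = c + 4 ∧ (2 : Fin 5) = c + 2 ∨
      (3 : Fin 5) = c + 4 ∧ b = c + 2 ∧ (2 : Fin 5) = c + 3) → c = 0 ∧ b = 4 ∨ c = 4 ∧ b = 1 := by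
  decide

/-- the picture «`y_0 ~ y_1`; neighbours to `y_3, y_4, y_2`». [cite: KhristoforovSmirnov2021, §2 Lemma 4, proof and Fig. 3 (p. 4)] -/
def picA : PicIdx 5 := (3, 4, 2, pairRel 0)

/-- the picture «`y_4 ~ y_0`; neighbours to `y_3, y_1, y_2`». [cite: KhristoforovSmirnov2021, §2 Lemma 4, proof and Fig. 3 (p. 4)] -/
def picB : PicIdx 5 := (3, 1, 2, pairRel 4)

/-- ★ at the witness face only the two pictures `picA`, `picB` are counted. [cite: KhristoforovSmirnov2021, §2 Lemma 4, proof and Fig. 3 (p. 4)] -/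
theorem pictureCount_vN_support {P : PicIdx 5} (h : pictureCount hexBall2Near vN P ≠ 0) : P = picA ∨ P = picB := by
  have hv := allSides_vN
  obtain ⟨q, hq, hP⟩ := exists_hasPicture_of_pictureCount_ne_zero h
  have e0 : P.1 = 3 := picFst_eq_of_corner_side hv oppFace_vN_zero hq hP
  have e2 : P.2.2.1 = 2 := picThd_eq_of_corner_side hv oppFace_vN_two hq hP
  have hT := tripodPicture_of_pictureCount_ne_zero hv h
  obtain ⟨c, hL, hread⟩ := tripodPicture_five hT
  obtain ⟨a, b, g, L⟩ := P
  simp only at e0 e2 hL hread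
  subst e0 e2 hL
  rcases five_face_cases c b hread with ⟨rfl, rfl⟩ | ⟨rfl, rfl⟩
  · exact Or.inl rfl
  · exact Or.inr rfl

/-- ★ **the face identity at the witness face**: for EVERY five-disorder class weight `w` discretely holomorphic on `hexBall2Near`,
`c_A·τ²·δ_0(w) + c_B·τ⁴·δ_4(w) = 0` with the picture counts `c_A, c_B ∈ ℕ` of the witness face.
[cite: KhristoforovSmirnov2021, §2 Lemma 4 eq. (3) (p. 4)] -/
theorem face_relation_vN {w : Fin 5 → Finset (Fin 5 × Fin 5) → ℂ} (hw : HolomorphicW hexBall2Near w) :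
    (pictureCount hexBall2Near vN picA : ℂ) * (tau ^ 2 * classDefect w 0) +
      (pictureCount hexBall2Near vN picB : ℂ) * (tau ^ 4 * classDefect w 4) = 0 := by
  have hv := allSides_vN
  have hsum := (holomorphicW_iff_sum_pictureCount hexBall2Near w).1 hw vN hv
  have hne : picA ≠ picB := by decide
  rw [Fintype.sum_eq_add picA picB hne (fun P hP => ?_)] at hsum
  · have dA : defectAt w picA = tau ^ 2 * classDefect w 0 := by
      have e2 : (0 : Fin 5) + 2 = 2 := by decide
      have e3 : (0 : Fin 5) + 3 = 3 := by decide
      have e4 : (0 : Fin 5) + 4 = 4 := by decide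
      show tripodDefect w 3 4 2 (pairRel 0) = tau ^ 2 * tripodDefect w (0 + 2) (0 + 3) (0 + 4) (pairRel 0)
      rw [e2, e3, e4]
      exact tripodDefect_rotate w 2 3 4 _
    have dB : defectAt w picB = tau ^ 4 * classDefect w 4 := by
      have e1 : (4 : Fin 5) + 2 = 1 := by decide
      have e2 : (4 : Fin 5) + 3 = 2 := by decide
      have e3 : (4 : Fin 5) + 4 = 3 := by decide
      show tripodDefect w 3 1 2 (pairRel 4) = tau ^ 4 * tripodDefect w (4 + 2) (4 + 3) (4 + 4) (pairRel 4)
      rw [e1, e2, e3, tripodDefect_rotate w 2 3 1, tripodDefect_rotate w 1 2 3]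
      ring
    rw [dA, dB] at hsum
    exact hsum
  · by_cases hc : pictureCount hexBall2Near vN P = 0
    · rw [hc, Nat.cast_zero, zero_mul]
    · exact absurd (pictureCount_vN_support hc) (not_or.2 hP)

/-- the counts at the witness face are not both zero (the witness core is re-linking and has one of the two pictures).
[cite: KhristoforovSmirnov2021, §2 Lemma 4, proof and Fig. 3 (p. 4)] -/
theorem pictureCount_vN_ne_zero : pictureCount hexBall2Near vN picA ≠ 0 ∨ pictureCount hexBall2Near vN picB ≠ 0 := by
  have hv := allSides_vN
  choose p hp using hbK_core_partners hv isCoreb_ζN not_xiLinked_N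
  have hcnt := pictureCount_ne_zero_of_core hv isCoreb_ζN not_xiLinked_N hp
  rcases pictureCount_vN_support hcnt with e | e
  · exact Or.inl (e ▸ hcnt)
  · exact Or.inr (e ▸ hcnt)

/-- index bookkeeping in `ℤ/5`. [folklore] -/
private theorem fin5_shift : ∀ c : Fin 5, (0 : Fin 5) - (4 - c) = c + 1 ∧ (4 : Fin 5) - (4 - c) = c := by decide

open Fin.NatCast in
/-- ★★★ **NECESSITY FOR FIVE DISORDERS**: a five-disorder class weight that is discretely holomorphic on EVERY five-marked domain has
all five class defects zero (witness: `hexBall2Near` and its five rotations — the face relation, transported by the cyclic relabelling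
of the marks, is a two-term recurrence around `ℤ/5` whose only solution is zero). [cite: KhristoforovSmirnov2021, §2 Lemma 4 (p. 4: sufficiency);
BollobasRiordan2006, Ch. 7 §7.2.2 (pp. 191–195), §7.2.3 p. 197] -/
theorem classDefect_eq_zero_of_forall_holomorphicW (wt : Fin 5 → Finset (Fin 5 × Fin 5) → ℂ)
    (h : ∀ D : TriMarkedDomain 5, HolomorphicW D wt) : ∀ c : Fin 5, classDefect wt c = 0 := by
  set cA : ℕ := pictureCount hexBall2Near vN picA with hcA
  set cB : ℕ := pictureCount hexBall2Near vN picB with hcB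
  have hrec : ∀ c : Fin 5, ((cA : ℂ) * tau ^ 2) * classDefect wt (c + 1) + ((cB : ℂ) * tau ^ 4) * classDefect wt c = 0 := by
    intro c
    have hw := face_relation_vN (forall_holomorphicW_iterate h ((4 - c : Fin 5) : ℕ) hexBall2Near)
    rw [classDefect_iterate, classDefect_iterate, Fin.cast_val_eq_self, (fin5_shift c).1, (fin5_shift c).2] at hw
    linear_combination hw
  exact cyclic_elim_five hrec (pow_five_add_ne_zero pictureCount_vN_ne_zero)

/-- ★★★ hence the TRIPOD LAW. [cite: KhristoforovSmirnov2021, §2 Lemma 4 (p. 4)] -/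
theorem tripodLaw_of_forall_holomorphicW_five (wt : Fin 5 → Finset (Fin 5 × Fin 5) → ℂ)
    (h : ∀ D : TriMarkedDomain 5, HolomorphicW D wt) : TripodLaw wt :=
  (tripodLaw_five_iff wt).2 (classDefect_eq_zero_of_forall_holomorphicW wt h)

/-- ★★★★ **FIVE DISORDERS: TRIPOD LAW ⟺ DISCRETE HOLOMORPHICITY ON EVERY FIVE-MARKED DOMAIN.** The forward implication is
Khristoforov–Smirnov's Lemma 4 for class weights (HOLO-K, every `k`); the converse is the necessity above.
[cite: KhristoforovSmirnov2021, §2 Lemma 4 (p. 4)] -/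
theorem tripodLaw_iff_forall_holomorphicW_five (wt : Fin 5 → Finset (Fin 5 × Fin 5) → ℂ) :
    TripodLaw wt ↔ ∀ D : TriMarkedDomain 5, HolomorphicW D wt :=
  ⟨fun h D => holomorphicW_of_tripodLaw' D h, tripodLaw_of_forall_holomorphicW_five wt⟩

end NecessityFive

/-! ### One domain up to relabelling suffices -/
section OneDomain

/-- holomorphicity on the `m`-fold rotated domain is holomorphicity of the `m`-fold back-rotated weight.
[cite: KhristoforovSmirnov2021, §2 Lemma 4 eq. (3) (p. 4); BollobasRiordan2006, Ch. 7 §7.2.3 p. 197 (re-marking by relabelling)] -/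
theorem holomorphicW_rotate_iterate_iff {n : ℕ} (m : ℕ) (D : TriMarkedDomain (n + 2)) (wt : Fin (n + 2) → Finset (Fin (n + 2) × Fin (n + 2)) → ℂ) :
    HolomorphicW (TriMarkedDomain.rotate^[m] D) wt ↔ HolomorphicW D ((rotW (rot (n + 2)).symm)^[m] wt) := by
  induction m generalizing wt with
  | zero => rfl
  | succ m ih => rw [Function.iterate_succ_apply', holomorphicW_rotate_iff, ih, Function.iterate_succ_apply]

open Fin.NatCast in
/-- ★★★ **FIVE DOMAINS SUFFICE** (one, up to relabelling of the marks): a five-disorder class weight that is discretely holomorphic on the five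
rotations `hexBall2Near, hexBall2Near.rotate, …` of the witness hexagon already has all class defects zero.
[cite: KhristoforovSmirnov2021, §2 Lemma 4 (p. 4); BollobasRiordan2006, Ch. 7 §7.2.2 (pp. 191–195), §7.2.3 p. 197] -/
theorem classDefect_eq_zero_of_holomorphicW_rotates (wt : Fin 5 → Finset (Fin 5 × Fin 5) → ℂ)
    (h : ∀ m : ℕ, m < 5 → HolomorphicW (TriMarkedDomain.rotate^[m] hexBall2Near) wt) : ∀ c : Fin 5, classDefect wt c = 0 := by
  set cA : ℕ := pictureCount hexBall2Near vN picA with hcA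
  set cB : ℕ := pictureCount hexBall2Near vN picB with hcB
  have hrec : ∀ c : Fin 5, ((cA : ℂ) * tau ^ 2) * classDefect wt (c + 1) + ((cB : ℂ) * tau ^ 4) * classDefect wt c = 0 := by
    intro c
    have hm : ((4 - c : Fin 5) : ℕ) < 5 := (4 - c).isLt
    have hw := face_relation_vN ((holomorphicW_rotate_iterate_iff _ hexBall2Near wt).1 (h _ hm))
    rw [classDefect_iterate, classDefect_iterate, Fin.cast_val_eq_self, (fin5_shift c).1, (fin5_shift c).2] at hw
    linear_combination hw
  exact cyclic_elim_five hrec (pow_five_add_ne_zero pictureCount_vN_ne_zero)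

/-- ★★★ hence: TRIPOD LAW ⟺ holomorphic on the five rotations of the witness hexagon ⟺ holomorphic on every five-marked domain.
[cite: KhristoforovSmirnov2021, §2 Lemma 4 (p. 4); BollobasRiordan2006, Ch. 7 §7.2.3 p. 197] -/
theorem tripodLaw_iff_holomorphicW_rotates (wt : Fin 5 → Finset (Fin 5 × Fin 5) → ℂ) :
    TripodLaw wt ↔ ∀ m : ℕ, m < 5 → HolomorphicW (TriMarkedDomain.rotate^[m] hexBall2Near) wt :=
  ⟨fun h _ _ => holomorphicW_of_tripodLaw' _ h, fun h => (tripodLaw_five_iff wt).2 (classDefect_eq_zero_of_holomorphicW_rotates wt h)⟩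

end OneDomain

/-! ### In Khristoforov–Smirnov's terms: no class-only holomorphic observable at five disorders except the constant -/
section ClassificationFive

/-- the class defects of an `L`-independent weight `c`. [cite: KhristoforovSmirnov2021, §2 Definition 3 (p. 4: `H_j`, `F = Σ_j τ^j H_j`)] -/
theorem classDefect_const (c : Fin 5 → ℂ) (c' : Fin 5) :
    classDefect (fun (j : Fin 5) (_ : Finset (Fin 5 × Fin 5)) => c j) c' = c (c' + 2) + tau * c (c' + 3) + tau ^ 2 * c (c' + 4) := rfl

/-- the five cyclic relations `c_j + τ c_{j+1} + τ² c_{j+2} = 0` force `c` to be CONSTANT (and conversely): the circulant symbol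
`1 + τ ω + τ² ω²` vanishes only at `ω ∈ {1, τ}`, and `τ` is not a fifth root of unity. [cite: KhristoforovSmirnov2021, §2 Definition 3 and Lemma 4 (p. 4)] -/
theorem const_relations_five_iff (c : Fin 5 → ℂ) :
    (∀ c' : Fin 5, c (c' + 2) + tau * c (c' + 3) + tau ^ 2 * c (c' + 4) = 0) ↔ ∀ j : Fin 5, c j = c 0 := by
  constructor
  · intro h
    have step : ∀ j : Fin 5, c (j + 1) = c j := by
      intro j
      have idx : ∀ j : Fin 5, j + 3 + 2 = j ∧ j + 3 + 3 = j + 1 ∧ j + 3 + 4 = j + 2 ∧ j + 1 + 2 = j + 3 ∧ j + 1 + 3 = j + 4 ∧ j + 1 + 4 = j := by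
        decide
      obtain ⟨i1, i2, i3, i4, i5, i6⟩ := idx j
      have e0 := h (j + 3)
      have e2 := h j
      have e3 := h (j + 1)
      rw [i1, i2, i3] at e0
      rw [i4, i5, i6] at e3
      linear_combination (-1 - tau) * e0 + (-tau) * e2 + (-1 - tau) * e3 +
        (tau * c j + c (j + 1) + tau * c (j + 2) + c (j + 3) + tau * c (j + 4)) * tau_sum₅
    have h1 := step 0
    have h2 := step (0 + 1)
    have h3 := step (0 + 1 + 1)
    have h4 := step (0 + 1 + 1 + 1)
    have all : ∀ j : Fin 5, j = 0 ∨ j = 0 + 1 ∨ j = 0 + 1 + 1 ∨ j = 0 + 1 + 1 + 1 ∨ j = 0 + 1 + 1 + 1 + 1 := by decide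
    intro j
    rcases all j with rfl | rfl | rfl | rfl | rfl
    · rfl
    · exact h1
    · exact h2.trans h1
    · exact h3.trans (h2.trans h1)
    · exact h4.trans (h3.trans (h2.trans h1))
  · intro h c'
    rw [h (c' + 2), h (c' + 3), h (c' + 4)]
    linear_combination (c 0) * tau_sum₅

/-- ★★★ **NO CLASS-ONLY PARAFERMION AT FIVE DISORDERS**: an `L`-INDEPENDENT five-disorder class weight `j ↦ c_j` (the observable
`Σ_j c_j · #{configurations of link class j}` on both halves of each subdivided edge) is discretely holomorphic on every five-marked domain
iff it is CONSTANT. In contrast with three disorders, where `F = Σ_j τ^j H_j` works (Khristoforov–Smirnov's Lemma 4; `holomorphic_combination_iff`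
of `MarkedLoopRelinkIndex`), a holomorphic five-disorder observable must weigh the link PATTERN, not only the class of the marked edge (as the
fan weight `fanWt 2` does). Not in print — Khristoforov–Smirnov define `F` for three disorders only (p. 4 eq. (2)); the five-class statement is the
lane's. [cite: KhristoforovSmirnov2021, §2 Definition 3 and Lemma 4 (p. 4); §3 Remark 6 (p. 5)] -/
theorem holomorphic_const_iff_five (c : Fin 5 → ℂ) :
    (∀ D : TriMarkedDomain 5, HolomorphicW D (fun (j : Fin 5) (_ : Finset (Fin 5 × Fin 5)) => c j)) ↔ ∀ j : Fin 5, c j = c 0 := by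
  rw [← tripodLaw_iff_forall_holomorphicW_five, tripodLaw_five_iff, ← const_relations_five_iff]
  simp only [classDefect_const]

end ClassificationFive

end Literature.Probability.Percolation.MarkedLoops
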